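import Mathlib
import HarnessLib
import HarnessLib.Audit
import Summits.FinalStateConjecture.Statement
import Literature.Geometry.Lorentzian.TameGenericityLocal
import Summits.FinalStateConjecture.FinalStateConjecture.Theorems.CurvatureOrSymmetryAssemblyFrame

/-!
Route: CurvatureOrSymmetry

DORMANT since 2026-09-04T18:32:55Z (reconciler: no traction for 5 d (last activity statement-checked at 2026-08-30T17:41:34Z); parked, not closed — `ledger route dormant route-FinalStateConjecture-CurvatureOrSymmetry --off` to reactivat) — unstaffed, not closed; items shared with open routes are served there. `ledger route dormant <id> --off` reactivates.

# Route CurvatureOrSymmetry — censorship fails only by curvature or by symmetry — follow the visible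
incomplete ray; the naked half of the exceptional set is exited at a visible p.p.-singular ray,
fountains being forbidden

It suffices to show X = NoFourthExit ∧ NoVacuumFountains ∧ TameCurvatureModeExit ∧
TameCensoredDataExit (cruxes ranked 2–5) ∧
MGHDExistence (the summit's shared MGHD-existence item, crux rank 9; CRUX-ONLY `closes`, rev 5: the
proved support
TameLocalExitSuffices is no longer assumed, the local exit being globalised inside the proof by
`InitialDataSet.isTameChristodoulouGeneric_of_local`; RE-TYPED for the Statement re-type T2,
p126844: the exits
deliver a family TAME on one fixed end and IMMERSED at 0, `IsTameDataFamily` + `IsImmersedAtZero`,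
and "good" carries the new conjuncts
`RaysStayInClosure`, honest-radii `HasExhaustiveCharts`, `IsFutureOriented`; the structure theorem
NoFourthExit/NoVacuumFountains is
untouched: it never mentions genericity or decompositions). NoFourthExit (card
censorship-fails-only-by-curvature-or-symmetry, K1 with K3(ii) folded in, ONE typed theorem about
ALL admissible
data, no genericity; K2 rides as the informal child ScaleCriticalUpgrade): if a maximal vacuum
Cauchy development has INCOMPLETE future null infinity (sojourn form) then it contains a VISIBLE
future-incomplete null geodesic γ — every point of γ lies in the chronological past of a
future-complete normalised null ray from the data
hypersurface — which ends EITHER (a) BY CURVATURE: the Riemann components in a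
parallelly propagated frame along γ are unbounded (a p.p. curvature singularity, HawkingEllis1973
§8.1), OR (c) BY SYMMETRY: a Killing
field K lives on an open set containing a tail of γ with g(K,γ') ≡ −1 and g(K,K) → 0 at the end of γ
(the shadow of a Killing horizon through a
fountain of the future Cauchy horizon). NoVacuumFountains (card K3(i), all data): for admissible
(complete, ONE-ENDED, asymptotically
flat) vacuum data alternative (c) never occurs with bounded curvature. TameCurvatureModeExit (card
K4, handing off to
TangentProfileCensorship's blow-up programme): through every admissible datum owning an MGHD with
incomplete 𝓘⁺ and a visible
p.p.-singular ray passes, on the datum's own (sole) asymptotically flat end e, an admissible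
injective curve TAME on e (jointly smooth,
DR-flat on e with continuous mass, continuous at c = 0 in the weighted C²₋₁ × C¹₋₂ distance of e)
and immersed at c = 0, whose small members c ≠ 0 are GOOD (an MGHD exists; every MGHD has complete
𝓘⁺ and a future-oriented,
honestly exhaustive sub-extremal Kerr decomposition of its exterior O whose closure keeps every
future-complete null ray from Σ).
TameCensoredDataExit is the same re-typing of the shared CensoredDataExit (offered verbatim to the
other exit routes). Both exits land in the FULL good set (card genericity-is-not-closed-under-and).
The old CurvatureModeExit / CensoredDataExit
entries stay as `replaced` records; the proved LocalExitSuffices / TameLocalExitSuffices stay as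
settled supports.
Lean: `NoFourthExit ∧ NoVacuumFountains ∧ TameCurvatureModeExit ∧ TameCensoredDataExit ∧
MGHDExistence`

## Assembly
Pure logic, crux-only (theorem `closes : NoFourthExit → NoVacuumFountains → TameCurvatureModeExit →
TameCensoredDataExit →
MGHDExistence → FinalStateConjecture`, rev 5, gate-native OK, axioms propext · Classical.choice ·
Quot.sound): fix X; by
`InitialDataSet.isTameChristodoulouGeneric_of_local` (TameGenericityLocal.lean: tame genericity is
local in the parameter) a LOCAL
good tame exit through each exceptional admissible D suffices; if every MGHD of D has complete 𝓘⁺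
then MGHDExistence gives an MGHD,
exceptionality gives one without a good (5-conjunct) decomposition, and TameCensoredDataExit exits;
otherwise some MGHD 𝒟 has
incomplete 𝓘⁺, NoFourthExit gives a visible incomplete ray with (a) or (c); if (a) fails, (c) holds
and NoVacuumFountains is
contradicted, so (a) holds and TameCurvatureModeExit exits. The instance binder `∀
[g.HasLeviCivita]` is threaded, never discharged.

Rationale: WHY THIS LINE. Every blow-up programme for weak cosmic censorship presupposes an object nobody has
proved to exist — a FIRST naked point where curvature
concentrates (route TangentProfileCensorship lists "the causal-boundary structure theorem" under NOT
DECOMPOSED YET); this route makes that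
object a theorem for ALL data by following light rays instead of fields: incompleteness of 𝓘⁺ hands
us incomplete rays, Clarke's
local-extension fork (doi:10.1007/BF01208376) splits curvature from extendibility, an extendible
visible end lies on the future Cauchy horizon
of the extension whose generator, pinned by asymptotic-flat exterior stability
(KlainermanNicolo2003, arXiv:2211.15230), runs pastward into
curvature or into a compact set (a fountain), and fountains are where Hawking's compactly-generated
no-go under NEC for NON-COMPACT partial
Cauchy surfaces (doi:10.1103/PhysRevD.46.603, made rigorous by arXiv:1406.5919;
book:krasnikov2018-back-time-faster-than-light-travel-general
§4.3) and the smooth compact-Cauchy-horizon rigidity theory (arXiv:1809.02580, arXiv:2008.02217,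
arXiv:2108.04056, after doi:10.1007/BF01214662)
live — HawkingEllis1973 §8.5 (Prop. 8.5.2: imprisoned incompleteness is a p.p. singularity unless
the curvature is algebraically special)
is the ur-form of "curvature or symmetry". Imported areas: Lorentzian causal theory / low-regularity
horizons (Minguzzi), Killing-horizon
rigidity from cosmological SCC moved to asymptotically flat WCC, and the ray-following censorship
programme of Newman–Królak
(doi:10.1007/BF00762446, doi:10.1088/0264-9381/3/3/004) which classified accessible singularities by
curvature strength but had neither
exterior stability nor horizon rigidity. What no prior route does: TangentProfileCensorship types
only the exit NakedDataExit; here the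
naked half is split by a genericity-free typed trichotomy whose symmetric branch is separately
killed, so three different communities
(causal geometry, horizon rigidity, blow-up analysis) get three disjoint, individually refutable
items. RE-TYPE 2026-08-16 (Statement re-type T2, p126844): genericity is now TAME on one fixed end
(`IsTameChristodoulouGeneric`: `IsTameDataFamily` + `IsImmersedAtZero`) and the good property gained
`RaysStayInClosure`, honest near-zone radii inside `HasExhaustiveCharts` and `IsFutureOriented`;
only the two EXIT items and the reparametrisation support see genericity or decompositions, so
exactly those were re-typed (TameCurvatureModeExit, TameCensoredDataExit, TameLocalExitSuffices) and
`closes` re-certified; the structure theorem (NoFourthExit, NoVacuumFountains) is untouched.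
Negatives index: one unrelated entry (UniformPhotonSphereChannels) at re-typing.

RANKED CRUXES. #2 NoFourthExit (crux) — NO FOURTH EXIT (card K1 with K3(ii) folded in; all
admissible data, no genericity): for every admissible datum D and every maximal vacuum Cauchy
development 𝒟 of D whose future null infinity is incomplete (sojourn form), there is a maximal null
geodesic γ with open affine domain dom ∋ 0 bounded above (future-incomplete), future-directed null
velocity, and VISIBLE — every γ(t), t ≥ 0, lies in I⁻ of the nonnegative-parameter image of some
future-complete normalised null ray from the data hypersurface — such that EITHER (a) some
parallelly propagated frame along γ (linearly independent at 0) has unbounded curvature components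
g(R(e_a,e_b)e_c,e_d)(γ t) on t ≥ 0, OR (c) there are an open U containing a tail γ([t₀, end)), a
smooth vector field K on U satisfying the Killing equation on U, with g(K(γ t), γ'(t)) = −1 on the
tail and g(K,K)(γ t) → 0 as t → sup dom. [difficulty: open-problem] (why it might fail: Clarke's
extension needs Hölder curvature control in a TUBE, not p.p.-boundedness on one curve; local
extensions along a generator need not glue Hausdorff-consistently (Misner branching); a
bounded-curvature generator of infinite past length, neither imprisoned nor escaping, is not
excluded.) [doi:10.1007/BF01208376, arXiv:gr-qc/9401015, HawkingEllis1973,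
doi:10.1103/PhysRevD.46.603, arXiv:1809.02580, arXiv:2008.02217, arXiv:2108.04056,
KlainermanNicolo2003, arXiv:2211.15230, doi:10.1007/BF00762446]
#3 NoVacuumFountains (crux) — NO FOUNTAINS FROM ONE-ENDED ASYMPTOTICALLY FLAT VACUUM DATA (card
K3(i); all admissible data): no maximal vacuum Cauchy development of an admissible datum contains a
visible future-incomplete null geodesic γ (as in NoFourthExit) along which (a) FAILS — every
parallel frame has bounded curvature components — while (c) HOLDS — a Killing field on an open set
around a tail of γ with g(K,γ') ≡ −1 and g(K,K) → 0 at the end. Intended proof: such a γ ends on a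
bounded-curvature piece of the future Cauchy horizon of a local extension carrying a null Killing
field, i.e. a Killing (fountain-type) horizon; localise Hawking's theorem — NEC (vacuum) +
non-compact partial Cauchy surface ⇒ H⁺ is not compactly generated (generators of a compactly
generated horizon are past complete, Minguzzi) — to the compact limit set of one imprisoned
generator, using the asymptotically flat exterior to pin the horizon's asymptotics. [difficulty: L]
(why it might fail: Hawking's area argument is GLOBAL on H⁺ (uses non-compactness of the whole
horizon); one imprisoned generator coexisting with incomplete ones is not excluded by it, and
degenerate (κ = 0) fountains have no rigidity theory; a dynamically formed visible Killing horizon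
would refute it.) [doi:10.1103/PhysRevD.46.603, arXiv:1406.5919, arXiv:1406.5909,
book:krasnikov2018-back-time-faster-than-light-travel-general, HawkingEllis1973,
arXiv:gr-qc/9811021, arXiv:1903.09135]
#4 TameCurvatureModeExit (crux) — TAME CURVATURE-MODE EXIT (re-type T2 of CurvatureModeExit; card K4
hand-off + the blow-up programme; local form): for every admissible datum D which has a maximal
vacuum Cauchy development with incomplete 𝓘⁺ containing a visible future-incomplete null geodesic
with a p.p. curvature blow-up (alternative (a) of NoFourthExit), there are one asymptotically flat
end e of X, a one-parameter family F of admissible data TAME on e (jointly smooth; every member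
Dafermos–Rodnianski-flat on e with continuous mass M(c); e.wDist(F c, F 0) → 0 as c → 0) and
IMMERSED at c = 0, injective, with F 0 = D, and ε > 0 such that for 0 < ‖c‖ < ε the datum F c is
good in the re-typed sense: it has an MGHD, and every MGHD has complete 𝓘⁺ and carries a
sub-extremal N-Kerr final-state decomposition d of O = exteriorOf 𝒟 d.charted with RaysStayInClosure
𝒟 O, HasExhaustiveCharts d (honest radii) and IsFutureOriented d. (The tame NakedDataExit with the
Step-1 object supplied as hypothesis.) [deps: NoFourthExit] [difficulty: open-problem] (why it might
fail: p.p. blow-up along one visible ray is weaker than the scale-critical concentration blow-up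
analysis consumes (KRS on lapse-collapsing foliations, open); arXiv:2605.16235: self-similar naked
singularities are stable at threshold regularity; the exit must be built TAME on D's own end
(weighted constraint gluing, CorvinoSchoen2006 / ChruscielDelay2003) and its members must also
SETTLE with complete rays kept in closure O.) [RodnianskiShlapentokhRothman2023, arXiv:2204.09891,
KlainermanRodnianskiSzeftel2015, arXiv:0801.1709, arXiv:2605.16235, Christodoulou1999instability,
An2025, CorvinoSchoen2006, ChruscielDelay2003]
#5 TameCensoredDataExit (crux) — TAME CENSORED DATA EXIT (re-type T2 of the shared CensoredDataExit;
the final-state half at censored data, local form; offered verbatim to TangentProfileCensorship /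
HomotheticSurfaceGravity / NoVacuumStrings for re-attachment): for every admissible datum D which
has an MGHD, all of whose MGHDs have complete 𝓘⁺, but some MGHD of which carries no sub-extremal
Kerr final-state decomposition d of its self-determined exterior O with RaysStayInClosure,
honest-radii HasExhaustiveCharts and IsFutureOriented, there are one end e of X, an injective
admissible one-parameter family F through D tame on e and immersed at 0, and ε > 0 with F c good (as
in #4) for 0 < ‖c‖ < ε. [difficulty: open-problem] (why it might fail: contains Kerr stability for
LARGE censored data (known only for |a| ≪ M, KlainermanSzeftel2023; barrier
SlowlyRotatingKerrFrontier) and non-genericity of extremal / infinitely-many-hole end states; a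
censored datum inside a Cantor-like threshold lamination has no exit curve; RaysStayInClosure adds
an interior claim for every good member (no future-complete null ray from Σ strictly inside the
black hole, i.e. Dafermos–Luk-type Cauchy-horizon termination); tame curves through D need the
constraint solution set to be a manifold in the DR-weighted class (Bartnik2005,
ChruscielDelay2003).) [DafermosLuk2017, KlainermanSzeftel2023, GiorgiKlainermanSzeftel2022,
DafermosHolzegelRodnianskiTaylor2021, KehleUnger2025, Bartnik2005, ChruscielDelay2003]
#9 VisibleIncompleteRay (support) — VISIBLE INCOMPLETE RAY (card P2 with P1; the sanity rung of
NoFourthExit, of which it is a corollary, provable independently): a maximal vacuum Cauchy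
development of an admissible datum with incomplete 𝓘⁺ (sojourn form) contains a visible
future-incomplete null geodesic. The sojourn negation supplies future-incomplete normalised rays
from arbitrarily far out with small sojourn in J⁺(ιB₀); asymptotically flat exterior stability
(Klainerman–Nicolò / Shen region: complete outgoing cones from large spheres of X) makes their
points visible. Tests the visibility idiom; rests on exterior stability for the admissible class (no
named fact yet). [difficulty: L] [Christodoulou1999, KlainermanNicolo2003, arXiv:2211.15230,
HawkingEllis1973]
#9 MGHDExistence (crux since rev 4, 2026-08-16: an unproved hypothesis of the crux-only `closes`,
hence a crux by the D-0027 layer invariant; the summit's shared item stmt-FinalStateConjecture-9937,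
crux-kinded in the sibling routes and staffed once) — every admissible datum has a maximal globally
hyperbolic vacuum development, stated over the repaired structure `VacuumCauchyDevelopment` (shared
verbatim with TangentProfileCensorship and most routes of this summit); Choquet-Bruhat–Geroch 1969
Thm. 3, Sbierski 2016 Thm. 2.6 — in the tree the undischarged named fact
`choquetBruhat_geroch_exists_mghd_cauchy`, which closes it by `exact
h.forall_mem_admissibleVacuumData` (AdmissibleMGHDExistence.lean) the day it is discharged; stated
INLINE so that the fact's module stays out of this route's cone. Known theorem; large formalisation.
[difficulty: XL] (why it might fail: only as typed — `IsMaximal` asks EVERY typed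
`VacuumCauchyDevelopment.{0}` of D to embed into one 𝒟; a rogue typed development falsifies it, as
the first rendering over `VacuumDevelopment` was (`VacuumDevelopment.isEmpty`).)
[ChoquetBruhatGeroch1969CMP, Sbierski2016AHP, Ringstrom2009,
Literature.Geometry.Lorentzian.choquetBruhat_geroch_exists_mghd_cauchy]
#9 TameLocalExitSuffices (support, PROVED 2026-08-16 by
Theorems/CurvatureOrSymmetryTameLocalExitSuffices.lean via
`InitialDataSet.exists_tameFamily_of_local`, item stmt-FinalStateConjecture-17350 closed; since rev
5 no longer a hypothesis of `closes`, which takes the same local-to-global step internally by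
`InitialDataSet.isTameChristodoulouGeneric_of_local` — the proof module imports this route file, so
no `_holds` link is possible) — TAME LOCAL EXIT SUFFICES (re-type T2 of LocalExitSuffices): if
through D passes, on some end e, a tame, immersed-at-0, injective admissible one-parameter family
whose members with 0 < ‖c‖ < ε avoid an exceptional set 𝓔, then through D passes one on the same e
all of whose members with c ≠ 0 avoid 𝓔 — reparametrise by the squash σ c = (ε·arctan(c₀)/2) e₀
(`PhotonSphereChannels.squash_spec`, `PhotonSphereChannels.isSmoothDataFamily_comp`, as in
Theorems/CurvatureOrSymmetryLocalExitSuffices.lean): IsSoleEnd and the ∀c DR-flatness are untouched,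
M ∘ σ is continuous, the wDist-continuity at 0 composes with σ → 0 (σ 0 = 0), immersion survives by
the chain rule (dσ(0) = (ε/2)·id and a non-zero fderiv at 0 forces differentiability there),
injectivity composes. [difficulty: provable-now] [Christodoulou1999]
#9 LocalExitSuffices (support, PROVED by Theorems/CurvatureOrSymmetryLocalExitSuffices.lean; kept as
the settled smooth-class record, no longer in the cone of `closes`) — LOCAL EXIT SUFFICES (shared
verbatim with TangentProfileCensorship): if through D passes a jointly smooth injective admissible
one-parameter family whose members with 0 < ‖c‖ < ε avoid an exceptional set 𝓔, then through D
passes one all of whose members with c ≠ 0 avoid 𝓔 — reparametrise by c ↦ (ε/2)·c/√(1+‖c‖²).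
[difficulty: provable-now] [Christodoulou1999, Christodoulou1999instability]

TWO-LAYER PLAN. Foreseen glued splits (nothing filed as typed children now; two INFORMAL cruxes are
filed after open, see Definition requests):
NoFourthExit ⇐ LocalExtensionFork → GeneratorPinning → FountainRigidity → NoFourthExit, where
LocalExtensionFork = a visible incomplete
null geodesic with bounded p.p. curvature (and bounded derivatives in a tube, the honest Clarke
hypothesis) has a C² local extension in
which it ends on the future Cauchy horizon of Σ; GeneratorPinning (card P1) = for admissible data D⁺
contains the Klainerman–Nicolò/Shen
exterior, so a visible Cauchy horizon is asymptotically outgoing and its generators run inward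
pastward: past p.p.-singular at finite
parameter (⇒ (a) along a visible ray of M) or imprisoned in a compact set; FountainRigidity (card
K3(ii)) = a compact invariant set of
bounded-curvature generators of a C^{1,1} null boundary piece in vacuum carries constant surface
gravity and, if κ ≠ 0, a one-sided
Killing field null on it (Petersen–Rácz / Bustamante–Reiris / Gurriaran–Minguzzi extended from
compact horizons to compact invariant
subsets) ⇒ (c). TameCurvatureModeExit ⇐ ScaleCriticalUpgrade → MinimalSingularTip →
TangentProfileExit, where ScaleCriticalUpgrade (card K2)
turns (a) into scale-critical L² curvature concentration r·∫_{B_r}|Rm|² ≥ ε₀ at the ideal end (KRS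
continuation run on lapse-collapsing
foliations, or a characteristic flux criterion), MinimalSingularTip (card K4) selects a ⊂-minimal
visible singular TIP with regular past
cone, and TangentProfileExit is the layer-2 chain of route TangentProfileCensorship (tangent
profile, smooth-class instability, two-sided
exit, quantisation, basin landing) started from that tip. If NoVacuumFountains dies, the symmetric
branch is re-filed as SymmetryModeExit
(card K3(iii): local Killing symmetry of an MGHD is Christodoulou-codimension ≥ 1, by a dynamical
transversality lemma) and `closes` re-certified.

KILL CRITERIA. A maximal vacuum Cauchy development of admissible data with incomplete 𝓘⁺ all of
whose visible incomplete rays have bounded p.p. curvature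
and no Killing-horizon shadow (a FOURTH EXIT: e.g. an asymptotically flat vacuum version of Clarke's
locally-extendible-globally-inextendible
ends, or a symmetry-free imprisoned generator) refutes NoFourthExit: close `refuted:NoFourthExit`
unless the witness is non-generic in an
evident way, in which case pivot to the generic-data version (file NoFourthExitGeneric, rank 2,
re-certify). A visible bounded-curvature
Killing horizon formed from one-ended AF vacuum data refutes NoVacuumFountains only: pivot to
SymmetryModeExit (Two-layer plan). Refutation
of TameCurvatureModeExit by a two-sided accumulation of smooth naked data at a p.p.-singular naked
datum refutes the censorship conjunct of the
typed summit itself (shared fate with TangentProfileCensorship's NakedDataExit); refutation of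
TameCensoredDataExit falsifies the typed summit; a refutation of either exit that only exploits
TAMENESS (no tame admissible curve through some admissible D at all) or `RaysStayInClosure` (a
good-looking member with a complete null ray inside its black hole) is a finding against the
re-typed Statement, to be reported `needs-human`, not a reason to close the line.
VisibleIncompleteRay refuted ⇒ the visibility idiom is misstated: repair both NoFourthExit and
TameCurvatureModeExit (misstated class), do not
close. A tame NakedDataExit proved in TangentProfileCensorship moots TameCurvatureModeExit (it
implies it) but not NoFourthExit/NoVacuumFountains,
which stay as the all-data structure theorem.

NOT DECOMPOSED YET. The AF pinning lemma P1 (exterior region with complete outgoing cones for the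
admissible o₂(r⁻¹)/o₁(r⁻²) class — Klainerman–Nicolò needs
weighted Sobolev decay of more derivatives; Shen/Bieri-type low-decay exterior results or a
KRS-level localisation must cover the gap);
the tube-versus-curve hypothesis of Clarke's extension theorem (we state (a) with p.p. frames, the
weakest curvature notion, so the burden
sits inside NoFourthExit's proof, as intended); Hausdorff gluing of local extensions along a
generator; the κ = 0 fountain; the
regularity of Cauchy horizons (C^{1,1}/semi-convex, Minguzzi) needed before rigidity applies; the
definition-level packaging
(VisibleIncompleteNullRay, PPCurvatureBlowupAlong, KillingHorizonShadowAlong) that would shorten the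
signatures; every constant.
New since the re-type: TAME ADMISSIBLE CURVES EXIST through every admissible datum (the vacuum
constraint set is a submanifold of the
DR-weighted phase space and compactly supported / Corvino–Schoen-glued directions give tame immersed
injective admissible lines — Bartnik2005,
ChruscielDelay2003, CorvinoSchoen2006; in-tree only the breathing family minus REPORT.md §5 Q5
lemmas MissingL3/L4), a support both exits
share; and the interior content of `RaysStayInClosure` for good members (Cauchy-horizon termination
of interior null rays, DafermosLuk2017).
These are layer-2 children or `--supports` lemmas.

CHEAPEST FALSIFIER. Literature check, one afternoon: (1) does Clarke's book (The Analysis of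
Space-Time Singularities, CUP 1993, Ch. 6–7) or Chruściel–Isenberg
(gr-qc/9401015) contain a VACUUM, asymptotically flat, one-ended example of a Cauchy horizon through
a visible locus whose generators are
neither past-incomplete at a curvature singularity nor imprisoned (a fourth exit)? (2) Is there a
vacuum AF spacetime developing from
complete one-ended data with a visible compactly generated or fountain-containing Cauchy horizon
(Hawking's theorem says NEC forbids
compactly generated ones from non-compact S; check Krasnikov 2018 §4.3 and Minguzzi arXiv:1406.5909
for the partially imprisoned case)?
Either finding kills NoFourthExit resp. NoVacuumFountains at once. I could not run (1): searchd was
unavailable all session and Clarke 1993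
is not held (acq wanted); (2) checked against Krasnikov 2018 pp. 106–121 (held): only compact-S or
WEC-violating examples are listed.

NUMBERS. Hawking 1992: NEC + non-compact partial Cauchy surface ⇒ H⁺(S) not compactly generated
(doi:10.1103/PhysRevD.46.603; smoothness lacuna
closed by Minguzzi arXiv:1406.5919 Thm. 1.3/§4); compactly generated ⇒ generators past complete
(arXiv:1406.5909; Krasnikov 2018 Prop. 19).
Compact non-degenerate Cauchy horizons in vacuum: constant κ ≠ 0 and a Killing field, smooth class,
no analyticity (arXiv:1809.02580 Thm 1.2,
arXiv:1903.09135, arXiv:2008.02217, arXiv:2108.04056). RSR vacuum naked singularities: metric C^N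
inside, C^{1,cε²} across the cone,
‖χ̂‖_L² ∼ ε⁻¹ (arXiv:1912.08478 Thm 1) — threshold regularity, NOT smooth admissible data, so no
known smooth vacuum naked singularity exists
to test NoFourthExit against. HE Prop. 8.5.2: imprisoned b-incomplete curve with R_ab K^a K^b ≠ 0
(or Weyl-generic) limit point ⇒ p.p.
singularity; Taub–NUT evades it only by algebraic speciality (HawkingEllis1973 pp. 289–292). Items
at open: 8 (4 cruxes,
3 supports, 1 assembly) + 2 informal cruxes to file (ScaleCriticalUpgrade rank 6, MinimalSingularTip
rank 7). After the 2026-08-16 re-type: 4 cruxes (NoFourthExit 2, NoVacuumFountains 3,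
TameCurvatureModeExit 4, TameCensoredDataExit 5), 4 typed supports (VisibleIncompleteRay,
MGHDExistence, LocalExitSuffices [proved],
TameLocalExitSuffices), 2 informal, 1 assembly = 11 items; `closes` re-certified (Sketch.lean farm
rc 0, standard axioms). After the crux-only repair (revs 3–5, 2026-08-16): imports =
[Literature.Geometry.Lorentzian.TameGenericityLocal] (the 5 redundant prelude imports dropped), 5
cruxes (NoFourthExit 2, NoVacuumFountains 3, TameCurvatureModeExit 4, TameCensoredDataExit 5,
MGHDExistence 9), supports VisibleIncompleteRay (open), LocalExitSuffices [proved],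
TameLocalExitSuffices [proved], 2 informal, 1 assembly (restated to the crux chain) = 11 items;
`closes : NoFourthExit → NoVacuumFountains → TameCurvatureModeExit → TameCensoredDataExit →
MGHDExistence → FinalStateConjecture` gate-native OK (hypotheses = the 5 cruxes, axioms propext ·
Classical.choice · Quot.sound), cone 157 constants, 0 unproved.

DEFINITION REQUESTS. D1 `VisibleIncompleteNullRay` (Literature/Geometry/Lorentzian): for a Cauchy
development 𝒟 and [g.HasLeviCivita], the predicate on (γ, dom)
inlined four times above (maximal null geodesic, 0 ∈ dom, BddAbove dom, future-directed null, every
γ t with t ≥ 0 in I⁻ of a future-complete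
normalised null ray from X). D2 `PPCurvatureBlowupAlong` (same topic): parallel frame along γ with
unbounded `CovariantDerivative.curvature`
components (HawkingEllis1973 §8.1 p.p. singularity). D3 `KillingHorizonShadowAlong` (same topic):
Killing field on an open set around a tail
with g(K,γ') ≡ −1, g(K,K) → 0. D4 `ScaleCriticalConcentrationAt`
(Summits/FinalStateConjecture/FinalStateConjecture/Theorems): KRS-style
r·∫_{B_r}|Rm|² on leaves of a local foliation with unit geometry control, for the informal crux
ScaleCriticalUpgrade. Cite-fact wanted:
exterior stability of Minkowski for the admissible class (KlainermanNicolo2003 Thm 1.1;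
arXiv:2211.15230 Thm 1.1) as `Literature` named fact
feeding VisibleIncompleteRay. Filed with `ledger workitem add --kind definition|statement` after
open.

Novelty: Searches (2026-08-15; searchd/`lit search` unavailable all session (exit 75), so: `lit frontier
FinalStateConjecture --since 2020` (30 rows; relevant
NEW: arXiv:2601.04152 "Obstructions to global visibility of singularities in asymptotically flat
spacetimes", 2026 — visibility side, no
trichotomy; arXiv:2412.09540 DSS exterior-naked singularities), `lit bridges FinalStateConjecture
--cross any` (30 rows, surveys: arXiv:2101.02687,
arXiv:2501.13180 SCC review, arXiv:2205.01680), `lit galaxy search "compactly generated Cauchy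
horizon" --star all` (12 rows: Minguzzi
arXiv:1406.5919 and arXiv:1406.5909, Hawking 1993 collection, Krasnikov 2018, Frolov–Zelnikov), `lit
galaxy search` pdf "cosmic censorship
curvature strength naked singularity Cauchy horizon generators" (0), "visibility of singularities
asymptotically flat" (0), `lit vsearch`
"NEC + non-compact partial Cauchy surface ⇒ horizon not compactly generated" (6 books:
HawkingEllis1973 pp. 289–292 READ, Krasnikov 2018
pp. 106–121 READ, Earman 1986, Rendall 2008); plus the card's own searches and its refuter novelty
audit (2026-08-15T15:00Z: Newman GRG 15/16
1983–84, Tipler GRG 17 (1985), Królak CQG 3 (1986), Clarke CMP 84 (1982)/CUP 1993 identified as the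
ray-following ancestor programme).
Nearest prior art found: doi:10.1007/BF00762446 (Newman 1984: future asymptotic predictability iff
no accessible weak-curvature naked
singularity — ray-following with curvature strength, no exterior stability, no rigidity);
doi:10.1088/026  [refs: 10.1007/BF00762446, 10.1088/0264-9381/3/3/004, 10.1103/PhysRevD.46.603, 2601.04152, 2412.09540, 2101.02687, 2501.13180, 2205.01680, 1406.5919, 1406.5909, 1809.02580, 2008.02217, doi:10.1007/BF00762446, doi:10.1088/0264-9381/3/3/004, doi:10.1103/PhysRevD.46.603, HawkingEllis1973]

Barriers (technique_class: causal-boundary, local-extensions, horizon-rigidity): - technique_class: causal-boundary, local-extensions, horizon-rigidity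
- Literature.Barriers.FinalStateConjecture.IonescuKlainermanNonExtension: met and respected — a
Killing field is produced only in the recurrent/compact (fountain) setting, where the smooth-class
theorems (Petersen–Rácz, Bustamante–Reiris) beat non-pseudoconvexity by recurrence, exactly the
barrier's recorded evasion class; no Killing field is continued backwards across a null hypersurface
to Σ (that is why the symmetric branch is killed by NoVacuumFountains / a transversality exit, never
by unique continuation).
- Literature.Barriers.FinalStateConjecture.nakedSingularityInstability: evaded on both sides — no
all-data censorship is claimed (NoFourthExit and NoVacuumFountains CLASSIFY failure for all data,
they do not forbid it), and genericity enters only through the exit items, which produce the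
transversal curve datum by datum (`IsChristodoulouGeneric … 1` shape); the regularity caveat
(threshold-regular naked singularities are stable, arXiv:2605.16235) bites only inside
CurvatureModeExit, shared with TangentProfileCensorship.
- Literature.Barriers.FinalStateConjecture.AretakisInstability: not engaged by the structure theorem
(no extremal horizon is a target of convergence); the degenerate fountain κ = 0 is its analogue and
is named as NoVacuumFountains' open branch; sub-extremality of final holes is demanded only inside
the exit items (ruling F4).
- Literature.Barriers.FinalStateConjecture.SlowlyRotating

History (route lifecycle, newest last):
- 2026-08-16T23:16:45Z · rev 2: restated CurvatureModeExit (stmt-FinalStateConjecture-10212), CensoredDataExit (stmt-FinalStateConjecture-9936), Assembly (stmt-FinalStateConjecture-10214) — route-repair (statement-revised p126844, re-type T2): exits re-typed to TAME immersed families on one fixed end with the 5-conjunct good property (RaysStay (planner-rrepair-FinalStateConjecture-Curvature-5cee64a3-0)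
- 2026-08-16T23:33:51Z · rev 5: restated Assembly (stmt-FinalStateConjecture-17349) — route-repair (glue, crux-only closes) step 2/2: `closes : NoFourthExit → NoVacuumFountains → TameCurvatureModeExit → TameCensoredDataExit → MGHDExistence → Fina (planner-rbadge-FinalStateConjecture-CurvatureO-3c6a8b25-0)
- 2026-08-24T05:54:42Z · DORMANT — reconciler: no traction for 6.6 d (last activity item-evidence-added at 2026-08-17T15:45:33Z); parked, not closed — `ledger route dormant route-FinalStateConjec (operator:999:3499220)
- 2026-08-30T17:05:49Z · REACTIVATED (open) — reconciler: reactivated — activity statement-checked at 2026-08-30T15:54:01Z after parking at 2026-08-24T05:54:42Z (operator:999:392585)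
- 2026-09-04T18:32:55Z · DORMANT — reconciler: no traction for 5 d (last activity statement-checked at 2026-08-30T17:41:34Z); parked, not closed — `ledger route dormant route-FinalStateConjecture (operator:999:2118991)

sub-problem: FinalStateConjecture · status: dormant · opened planner-plancard-FinalStateConjecture-FinalSt-af2336ce-0 2026-08-15T15:33:16Z · rev 6 · ledger route-FinalStateConjecture-CurvatureOrSymmetry
GENERATED by the gate from the ledger (D-0016/17). Provers cite these decls: `theorem foo : Summit.FinalStateConjecture.FinalStateConjecture.Theses.CurvatureOrSymmetry.<Decl> := …` in Summits/FinalStateConjecture/FinalStateConjecture/Theorems/<Name>.lean.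
-/

namespace Summit.FinalStateConjecture.FinalStateConjecture.Theses.CurvatureOrSymmetry

open scoped BigOperators Topology Manifold Classical MeasureTheory ProbabilityTheory Matrix InnerProductSpace ComplexConjugate ContinuousMap
open Filter Set Function TopologicalSpace MeasureTheory

attribute [summit_statement] _root_.FinalStateConjecture

/-- item stmt-FinalStateConjecture-10210 · crux · rank 2 · open · by planner
why it might fail: Bounded p.p. curvature on visible rays gives no C² extension (Clarke needs Hölder control in a tube): rough-bounded or quasi-regular visible ends satisfy neither (a) nor (c); Killing rigidity is proved only for whole compact κ≠0 horizons (1809.02580, 2008.11926), not one imprisoned generator or κ=0.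
sources: doi:10.1007/BF01645592, doi:10.1007/BF01208481, doi:10.1007/BF00759240, arXiv:gr-qc/9401015, HawkingEllis1973, doi:10.1103/PhysRevD.46.603
[crux] NO FOURTH EXIT (card K1 with K3(ii) folded in; all admissible data, no genericity): for every
admissible datum D and every maximal vacuum Cauchy development 𝒟 of D whose future null infinity is
incomplete (sojourn form), there is a maximal null geodesic γ with open affine domain dom ∋ 0
bounded above (future-incomplete), future-directed null velocity, and VISIBLE — every γ(t), t ≥ 0,
lies in I⁻ of the nonnegative-parameter image of some future-complete normalised null ray from the
data hypersurface — such that EITHER (a) some parallelly propagated frame along γ (linearly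
independent at 0) has unbounded curvature components g(R(e_a,e_b)e_c,e_d)(γ t) on t ≥ 0, OR (c)
there are an open U containing a tail γ([t₀, end)), a smooth vector field K on U satisfying the
Killing equation on U, with g(K(γ t), γ'(t)) = −1 on the tail and g(K,K)(γ t) → 0 as t → sup dom.
[difficulty: open-problem] -/
@[route_item "route-FinalStateConjecture-CurvatureOrSymmetry"]
def NoFourthExit : Prop :=
  ∀ (X : Type) [TopologicalSpace X] [ChartedSpace Literature.Geometry.Lorentzian.E3 X] [IsManifold (𝓡 3) ((⊤ : ℕ∞) : WithTop ℕ∞) X] [T2Space X] [SecondCountableTopology X] [ConnectedSpace X], ∀ D ∈ Literature.Geometry.Lorentzian.admissibleVacuumData X, ∀ 𝒟 : Literature.Geometry.Lorentzian.VacuumCauchyDevelopment D, 𝒟.IsMaximal → ¬ Summit.FinalStateConjecture.HasCompleteNullInfinity 𝒟.toCauchyDevelopment → ∀ [𝒟.metric.HasLeviCivita], ∃ (γ : ℝ → 𝒟.carrier) (dom : Set ℝ), (Literature.Geometry.Lorentzian.IsMaximalGeodesicOn 𝒟.metric.leviCivita γ dom ∧ (0 : ℝ) ∈ dom ∧ BddAbove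 dom ∧ (∀ t ∈ dom, 𝒟.metric.IsNull (Literature.Geometry.Lorentzian.velocity (𝓡 4) γ t) ∧ 𝒟.timeOrientation.IsFutureDirected (Literature.Geometry.Lorentzian.velocity (𝓡 4) γ t)) ∧ (∀ t ∈ dom, 0 ≤ t → (∃ (p : X) (δ : ℝ → 𝒟.carrier) (s : Set ℝ), 𝒟.metric.IsNormalisedNullRayFrom 𝒟.timeOrientation 𝒟.embed 𝒟.normal p δ s ∧ ¬ BddAbove s ∧ γ t ∈ 𝒟.metric.chronologicalPast 𝒟.timeOrientation (δ '' (s ∩ Set.Ici 0))))) ∧ ((∃ e : Fin 4 → (Π t : ℝ, TangentSpace (𝓡 4) (γ t)), (∀ a, ∀ t ∈ dom, MDifferentiableAt 𝓘(ℝ, ℝ) (𝓡 4).tangent (fun s : ℝ ↦ (Bundle.TotalSpace.mk' Literature.Geometry.Lorentzian.E4 (γ s) (e a s) : TangentBundle (𝓡 4) 𝒟.carrier)) t ∧ Literature.Geometry.Lorentzian.covariantDerivAlong 𝒟.metric.leviCivita γ (e a) t = 0) ∧ LinearIndependent ℝ (fun a ↦ e a 0) ∧ ∀ C : ℝ, ∃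 t ∈ dom, 0 ≤ t ∧ ∃ a b c d : Fin 4, C < |𝒟.metric.val (γ t) (CovariantDerivative.curvature 𝒟.metric.leviCivita (γ t) (e a t) (e b t) (e c t)) (e d t)|) ∨ (∃ (U : Set 𝒟.carrier) (K : Π x : 𝒟.carrier, TangentSpace (𝓡 4) x) (t₀ : ℝ), IsOpen U ∧ t₀ ∈ dom ∧ (∀ t ∈ dom, t₀ ≤ t → γ t ∈ U) ∧ ContMDiffOn (𝓡 4) ((𝓡 4).prod 𝓘(ℝ, Literature.Geometry.Lorentzian.E4)) ((⊤ : ℕ∞) : WithTop ℕ∞) (fun x ↦ (Bundle.TotalSpace.mk' Literature.Geometry.Lorentzian.E4 x (K x) : TangentBundle (𝓡 4) 𝒟.carrier)) U ∧ (∀ x ∈ U, ∀ v w : TangentSpace (𝓡 4) x, 𝒟.metric.val x (𝒟.metric.leviCivita K x v) w + 𝒟.metric.val x v (𝒟.metric.leviCivita K x w) = 0) ∧ (∀ t ∈ dom, t₀ ≤ t → 𝒟.metric.val (γ t) (K (γ t)) (Literature.Geometry.Lorentzian.velocity (𝓡 4) γ t) = -1) ∧ Filter.Tendsto (fun t : ℝ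 ↦ 𝒟.metric.val (γ t) (K (γ t)) (K (γ t))) (nhdsWithin (sSup dom) dom) (nhds 0)))

/-- item stmt-FinalStateConjecture-10211 · crux · rank 3 · open · by planner
why it might fail: Hawking–Minguzzi is per horizon component (1406.5919 Thm 18); (c) as typed holds for any local null Killing field; Ori's AF time machines from R³ data obeying WEC (gr-qc/0503077) have vacuum cores ending on bounded-curvature Killing fountains: a vacuum envelope + no engulfing black hole refutes it.
sources: arXiv:gr-qc/0503077, arXiv:gr-qc/0701024, doi:10.1103/PhysRevD.46.603, arXiv:1406.5919, arXiv:1406.5909, book:krasnikov2018-back-time-faster-than-light-travel-general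
[crux] NO FOUNTAINS FROM ONE-ENDED ASYMPTOTICALLY FLAT VACUUM DATA (card K3(i); all admissible
data): no maximal vacuum Cauchy development of an admissible datum contains a visible
future-incomplete null geodesic γ (as in NoFourthExit) along which (a) FAILS — every parallel frame
has bounded curvature components — while (c) HOLDS — a Killing field on an open set around a tail of
γ with g(K,γ') ≡ −1 and g(K,K) → 0 at the end. Intended proof: such a γ ends on a bounded-curvature
piece of the future Cauchy horizon of a local extension carrying a null Killing field, i.e. a
Killing (fountain-type) horizon; localise Hawking's theorem — NEC (vacuum) + non-compact partial
Cauchy surface ⇒ H⁺ is not compactly generated (generators of a compactly generated horizon are past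
complete, Minguzzi) — to the compact limit set of one imprisoned generator, using the asymptotically
flat exterior to pin the horizon's asymptotics. [difficulty: L] -/
@[route_item "route-FinalStateConjecture-CurvatureOrSymmetry"]
def NoVacuumFountains : Prop :=
  ∀ (X : Type) [TopologicalSpace X] [ChartedSpace Literature.Geometry.Lorentzian.E3 X] [IsManifold (𝓡 3) ((⊤ : ℕ∞) : WithTop ℕ∞) X] [T2Space X] [SecondCountableTopology X] [ConnectedSpace X], ∀ D ∈ Literature.Geometry.Lorentzian.admissibleVacuumData X, ∀ 𝒟 : Literature.Geometry.Lorentzian.VacuumCauchyDevelopment D, 𝒟.IsMaximal → ∀ [𝒟.metric.HasLeviCivita], ¬ ∃ (γ : ℝ → 𝒟.carrier) (dom : Set ℝ), (Literature.Geometry.Lorentzian.IsMaximalGeodesicOn 𝒟.metric.leviCivita γ dom ∧ (0 : ℝ) ∈ dom ∧ BddAbove dom ∧ (∀ t ∈ dom, 𝒟.metric.IsNull (Literature.Geometry.Lorentzian.velocity (𝓡 4) γ t) ∧ 𝒟.timeOrientation.IsFutureDirected (Literature.Geometry.Lorentzian.velocity (𝓡 4) γ t)) ∧ (∀ t ∈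 dom, 0 ≤ t → (∃ (p : X) (δ : ℝ → 𝒟.carrier) (s : Set ℝ), 𝒟.metric.IsNormalisedNullRayFrom 𝒟.timeOrientation 𝒟.embed 𝒟.normal p δ s ∧ ¬ BddAbove s ∧ γ t ∈ 𝒟.metric.chronologicalPast 𝒟.timeOrientation (δ '' (s ∩ Set.Ici 0))))) ∧ ¬ (∃ e : Fin 4 → (Π t : ℝ, TangentSpace (𝓡 4) (γ t)), (∀ a, ∀ t ∈ dom, MDifferentiableAt 𝓘(ℝ, ℝ) (𝓡 4).tangent (fun s : ℝ ↦ (Bundle.TotalSpace.mk' Literature.Geometry.Lorentzian.E4 (γ s) (e a s) : TangentBundle (𝓡 4) 𝒟.carrier)) t ∧ Literature.Geometry.Lorentzian.covariantDerivAlong 𝒟.metric.leviCivita γ (e a) t = 0) ∧ LinearIndependent ℝ (fun a ↦ e a 0) ∧ ∀ C : ℝ, ∃ t ∈ dom, 0 ≤ t ∧ ∃ a b c d : Fin 4, C < |𝒟.metric.val (γ t) (CovariantDerivative.curvature 𝒟.metric.leviCivita (γ t) (e a t) (e b t) (e c t)) (e d t)|) ∧ (∃ (U : Set 𝒟.carrier)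 (K : Π x : 𝒟.carrier, TangentSpace (𝓡 4) x) (t₀ : ℝ), IsOpen U ∧ t₀ ∈ dom ∧ (∀ t ∈ dom, t₀ ≤ t → γ t ∈ U) ∧ ContMDiffOn (𝓡 4) ((𝓡 4).prod 𝓘(ℝ, Literature.Geometry.Lorentzian.E4)) ((⊤ : ℕ∞) : WithTop ℕ∞) (fun x ↦ (Bundle.TotalSpace.mk' Literature.Geometry.Lorentzian.E4 x (K x) : TangentBundle (𝓡 4) 𝒟.carrier)) U ∧ (∀ x ∈ U, ∀ v w : TangentSpace (𝓡 4) x, 𝒟.metric.val x (𝒟.metric.leviCivita K x v) w + 𝒟.metric.val x v (𝒟.metric.leviCivita K x w) = 0) ∧ (∀ t ∈ dom, t₀ ≤ t → 𝒟.metric.val (γ t) (K (γ t)) (Literature.Geometry.Lorentzian.velocity (𝓡 4) γ t) = -1) ∧ Filter.Tendsto (fun t : ℝ ↦ 𝒟.metric.val (γ t) (K (γ t)) (K (γ t))) (nhdsWithin (sSup dom) dom) (nhds 0))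

/-- item stmt-FinalStateConjecture-17347 · crux · rank 4 · open · by planner
why it might fail: p.p. blow-up on one visible ray is weaker than the scale-critical concentration blow-up analysis uses (KRS on collapsing-lapse foliations, open); threshold-regular naked singularities are stable (2605.16235); the exit must be TAME on D's end and its members must settle, complete rays in closure O.
sources: RodnianskiShlapentokhRothman2023, arXiv:2204.09891, arXiv:1912.08478, KlainermanRodnianskiSzeftel2015, arXiv:0801.1709, arXiv:2605.16235
[crux] TAME CURVATURE-MODE EXIT (re-type T2 of CurvatureModeExit, Statement p126844, 2026-08-16;
card K4 hand-off + the blow-up programme; local form): for every admissible datum D which has a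
maximal vacuum Cauchy development with incomplete 𝓘⁺ containing a visible future-incomplete null
geodesic with a p.p. curvature blow-up (alternative (a) of NoFourthExit), there are ONE
asymptotically flat end e of X, a one-parameter family F of admissible data TAME on e
(`IsTameDataFamily e 1 F`: jointly smooth; e the sole end; every member Dafermos–Rodnianski-flat on
e with continuous mass M(c); e.wDist (F c) (F 0) → 0 as c → 0) and IMMERSED at c = 0
(`IsImmersedAtZero 1 F`), injective, F 0 = D, and ε > 0 such that for 0 < ‖c‖ < ε the datum F c is
good in the re-typed sense: it has an MGHD, and every MGHD has complete 𝓘⁺ and carries a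
sub-extremal N-Kerr final-state decomposition d of O = exteriorOf 𝒟 d.charted with RaysStayInClosure
𝒟 O, HasExhaustiveCharts d (honest radii) and IsFutureOriented d. (The tame NakedDataExit of
TangentProfileCensorship with the Step-1 object supplied as hypothesis; implies the replaced
CurvatureModeExit.) [deps: NoFourthExit] [difficulty: open-problem] -/
@[route_item "route-FinalStateConjecture-CurvatureOrSymmetry"]
def TameCurvatureModeExit : Prop :=
  ∀ (X : Type) [TopologicalSpace X] [ChartedSpace Literature.Geometry.Lorentzian.E3 X] [IsManifold (𝓡 3) ((⊤ : ℕ∞) : WithTop ℕ∞) X] [T2Space X] [SecondCountableTopology X] [ConnectedSpace X], ∀ D ∈ Literature.Geometry.Lorentzian.admissibleVacuumData X, (∃ 𝒟 : Literature.Geometry.Lorentzian.VacuumCauchyDevelopment D, 𝒟.IsMaximal ∧ ¬ Summit.FinalStateConjecture.HasCompleteNullInfinity 𝒟.toCauchyDevelopment ∧ ∀ [𝒟.metric.HasLeviCivita], ∃ (γ : ℝ → 𝒟.carrier) (dom : Set ℝ), (Literature.Geometry.Lorentzian.IsMaximalGeodesicOn 𝒟.metric.leviCivita γ dom ∧ (0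 : ℝ) ∈ dom ∧ BddAbove dom ∧ (∀ t ∈ dom, 𝒟.metric.IsNull (Literature.Geometry.Lorentzian.velocity (𝓡 4) γ t) ∧ 𝒟.timeOrientation.IsFutureDirected (Literature.Geometry.Lorentzian.velocity (𝓡 4) γ t)) ∧ (∀ t ∈ dom, 0 ≤ t → (∃ (p : X) (δ : ℝ → 𝒟.carrier) (s : Set ℝ), 𝒟.metric.IsNormalisedNullRayFrom 𝒟.timeOrientation 𝒟.embed 𝒟.normal p δ s ∧ ¬ BddAbove s ∧ γ t ∈ 𝒟.metric.chronologicalPast 𝒟.timeOrientation (δ '' (s ∩ Set.Ici 0))))) ∧ (∃ e : Fin 4 → (Π t : ℝ, TangentSpace (𝓡 4) (γ t)), (∀ a, ∀ t ∈ dom, MDifferentiableAt 𝓘(ℝ, ℝ) (𝓡 4).tangent (fun s : ℝ ↦ (Bundle.TotalSpace.mk' Literature.Geometry.Lorentzian.E4 (γ s) (e a s) : TangentBundle (𝓡 4) 𝒟.carrier)) t ∧ Literature.Geometry.Lorentzian.covariantDerivAlong 𝒟.metric.leviCivita γ (e a) t = 0) ∧ LinearIndependent ℝ (fun a ↦ e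 a 0) ∧ ∀ C : ℝ, ∃ t ∈ dom, 0 ≤ t ∧ ∃ a b c d : Fin 4, C < |𝒟.metric.val (γ t) (CovariantDerivative.curvature 𝒟.metric.leviCivita (γ t) (e a t) (e b t) (e c t)) (e d t)|)) → ∃ (e : Literature.Geometry.Lorentzian.AFEnd X) (F : EuclideanSpace ℝ (Fin 1) → Literature.Geometry.Lorentzian.InitialDataSet (𝓡 3) X), Literature.Geometry.Lorentzian.InitialDataSet.IsTameDataFamily e 1 F ∧ Literature.Geometry.Lorentzian.InitialDataSet.IsImmersedAtZero 1 F ∧ F 0 = D ∧ Function.Injective F ∧ (∀ c, F c ∈ Literature.Geometry.Lorentzian.admissibleVacuumData X) ∧ ∃ ε : ℝ, 0 < ε ∧ ∀ c, c ≠ 0 → ‖c‖ < ε → ((∃ 𝒟 : Literature.Geometry.Lorentzian.VacuumCauchyDevelopment (F c), 𝒟.IsMaximal) ∧ ∀ 𝒟 : Literature.Geometry.Lorentzian.VacuumCauchyDevelopment (F c), 𝒟.IsMaximal → Summit.FinalStateConjecture.HasCompleteNullInfinity 𝒟.toCauchyDevelopment ∧ ∃ (O : Set 𝒟.carrier) (d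 : Literature.Geometry.Lorentzian.FinalStateDecomposition 𝒟.toSpacetime O 2), (∀ i, Literature.Geometry.Lorentzian.Kerr.IsSubextremal (d.mass i) (d.spin i)) ∧ O = Summit.FinalStateConjecture.exteriorOf 𝒟.toCauchyDevelopment d.charted ∧ Summit.FinalStateConjecture.RaysStayInClosure 𝒟.toCauchyDevelopment O ∧ Summit.FinalStateConjecture.HasExhaustiveCharts d ∧ Summit.FinalStateConjecture.IsFutureOriented d)

/-- item stmt-FinalStateConjecture-17348 · crux · rank 5 · open · by planner
why it might fail: Contains large-data Kerr stability (only |a| ≪ M known, KlainermanSzeftel2023) and non-genericity of extremal/infinitely-many-hole ends; a Cantor-like threshold lamination at D has no exit curve; RaysStayInClosure adds an interior claim; tame curves through D need a DR-weighted constraint manifold.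
sources: DafermosLuk2017, KlainermanSzeftel2023, GiorgiKlainermanSzeftel2022, DafermosHolzegelRodnianskiTaylor2021, KehleUnger2025, Bartnik2005
[crux] TAME CENSORED DATA EXIT (re-type T2 of the shared CensoredDataExit, Statement p126844,
2026-08-16; the final-state half at censored data, local form; offered verbatim to
TangentProfileCensorship / HomotheticSurfaceGravity / NoVacuumStrings for re-attachment): for every
X as above and every admissible datum D which has an MGHD, all of whose MGHDs have complete 𝓘⁺, but
some MGHD of which carries no sub-extremal Kerr final-state decomposition d of its self-determined
exterior O = exteriorOf 𝒟 d.charted with RaysStayInClosure 𝒟 O, HasExhaustiveCharts d (honest radii)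
and IsFutureOriented d, there are one asymptotically flat end e of X, an injective one-parameter
admissible family F through D (F 0 = D) tame on e and immersed at 0, and ε > 0 with F c good (as in
TameCurvatureModeExit) for 0 < ‖c‖ < ε. [difficulty: open-problem] -/
@[route_item "route-FinalStateConjecture-CurvatureOrSymmetry"]
def TameCensoredDataExit : Prop :=
  ∀ (X : Type) [TopologicalSpace X] [ChartedSpace Literature.Geometry.Lorentzian.E3 X] [IsManifold (𝓡 3) ((⊤ : ℕ∞) : WithTop ℕ∞) X] [T2Space X] [SecondCountableTopology X] [ConnectedSpace X], ∀ D ∈ Literature.Geometry.Lorentzian.admissibleVacuumData X, (∃ 𝒟 : Literature.Geometry.Lorentzian.VacuumCauchyDevelopment D, 𝒟.IsMaximal) → (∀ 𝒟 : Literature.Geometry.Lorentzian.VacuumCauchyDevelopment D, 𝒟.IsMaximal → Summit.FinalStateConjecture.HasCompleteNullInfinity 𝒟.toCauchyDevelopment) → (∃ 𝒟 : Literature.Geometry.Lorentzian.VacuumCauchyDevelopment D, 𝒟.IsMaximal ∧ ¬ ∃ (O : Set 𝒟.carrier) (d : Literature.Geometry.Lorentzian.FinalStateDecomposition 𝒟.toSpacetime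 O 2), (∀ i, Literature.Geometry.Lorentzian.Kerr.IsSubextremal (d.mass i) (d.spin i)) ∧ O = Summit.FinalStateConjecture.exteriorOf 𝒟.toCauchyDevelopment d.charted ∧ Summit.FinalStateConjecture.RaysStayInClosure 𝒟.toCauchyDevelopment O ∧ Summit.FinalStateConjecture.HasExhaustiveCharts d ∧ Summit.FinalStateConjecture.IsFutureOriented d) → ∃ (e : Literature.Geometry.Lorentzian.AFEnd X) (F : EuclideanSpace ℝ (Fin 1) → Literature.Geometry.Lorentzian.InitialDataSet (𝓡 3) X), Literature.Geometry.Lorentzian.InitialDataSet.IsTameDataFamily e 1 F ∧ Literature.Geometry.Lorentzian.InitialDataSet.IsImmersedAtZero 1 F ∧ F 0 = D ∧ Function.Injective F ∧ (∀ c, F c ∈ Literature.Geometry.Lorentzian.admissibleVacuumData X) ∧ ∃ ε : ℝ, 0 < ε ∧ ∀ c, c ≠ 0 → ‖c‖ < ε → ((∃ 𝒟 : Literature.Geometry.Lorentzian.VacuumCauchyDevelopment (F c), 𝒟.IsMaximal) ∧ ∀ 𝒟 : Literature.Geometry.Lorentzian.VacuumCauchyDevelopment (F c), 𝒟.IsMaximal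 → Summit.FinalStateConjecture.HasCompleteNullInfinity 𝒟.toCauchyDevelopment ∧ ∃ (O : Set 𝒟.carrier) (d : Literature.Geometry.Lorentzian.FinalStateDecomposition 𝒟.toSpacetime O 2), (∀ i, Literature.Geometry.Lorentzian.Kerr.IsSubextremal (d.mass i) (d.spin i)) ∧ O = Summit.FinalStateConjecture.exteriorOf 𝒟.toCauchyDevelopment d.charted ∧ Summit.FinalStateConjecture.RaysStayInClosure 𝒟.toCauchyDevelopment O ∧ Summit.FinalStateConjecture.HasExhaustiveCharts d ∧ Summit.FinalStateConjecture.IsFutureOriented d)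

/-- item stmt-FinalStateConjecture-9937 · crux · rank 9 · open · by planner
why it might fail: In print (CBG 1969 Thm 3) but an undischarged XL fact here (choquetBruhat_geroch_exists_mghd_cauchy), typing-exposed: IsMaximal asks EVERY typed VacuumCauchyDevelopment.{0} of D to embed into one 𝒟; a rogue typed development falsifies it (1st render over VacuumDevelopment: isEmpty).
sources: ChoquetBruhatGeroch1969CMP, Sbierski2016AHP, Ringstrom2009, Literature.Geometry.Lorentzian.choquetBruhat_geroch_exists_mghd_cauchy, Literature.Geometry.Lorentzian.choquetBruhat_geroch_exists_mghd_cauchy.forall_mem_admissibleVacuumData, Literature.Geometry.Lorentzian.VacuumDevelopment.isEmpty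
[support] every admissible datum has a maximal globally hyperbolic vacuum development, stated over
the repaired structure `VacuumCauchyDevelopment` (the corrected form of the deprecated
`choquetBruhat_geroch_exists_mghd`, recorded in `CauchyProblemExistenceDefect`);
Choquet-Bruhat–Geroch 1969 Thm. 3, Sbierski 2016 Thm. 2.6. Known theorem; large formalisation;
shared by every route of this summit. [difficulty: XL] -/
@[route_item "route-FinalStateConjecture-CurvatureOrSymmetry"]
def MGHDExistence : Prop :=
  ∀ (X : Type) [TopologicalSpace X] [ChartedSpace Literature.Geometry.Lorentzian.E3 X] [IsManifold (𝓡 3) ((⊤ : ℕ∞) : WithTop ℕ∞) X] [T2Space X] [SecondCountableTopology X] [ConnectedSpace X], ∀ D ∈ Literature.Geometry.Lorentzian.admissibleVacuumData X, ∃ 𝒟 : Literature.Geometry.Lorentzian.VacuumCauchyDevelopment D, 𝒟.IsMaximal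

-- item stmt-FinalStateConjecture-10222 · support · rank 6 · open · by planner — informal only, no Lean statement yet:
--   [crux] SCALE-CRITICAL UPGRADE (card K2; foreseen child of CurvatureModeExit in the glued split
--   ScaleCriticalUpgrade -> MinimalSingularTip -> TangentProfileExit -> CurvatureModeExit). For an MGHD
--   of admissible data and a visible future-incomplete null geodesic gamma with a p.p. curvature blow-up
--   (alternative (a) of NoFourthExit): on the leaves of any local foliation near the ideal end p of
--   gamma with unit-size geometry control (lapse, second fundamental form, injectivity/volume radius),
--   the scale-critical curvature energy r * int_{B_r(x)} |Rm|^2 does NOT stay below epsilon_0 on all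
--   balls shrink

-- item stmt-FinalStateConjecture-10223 · support · rank 7 · open · by planner — informal only, no Lean statement yet:
--   [crux] MINIMAL VISIBLE SINGULAR TIP (card K4; foreseen child of CurvatureModeExit). For every
--   admissible datum and every MGHD with incomplete scri+ admitting alternative (a) of NoFourthExit,
--   there is a visible p.p.-singular future-incomplete null geodesic gamma which is EARLIEST: the causal
--   past of gamma inside J+(iota X) contains no other future-incomplete maximal causal geodesic except
--   those ending where gamma ends (subset-minimal singular terminal indecomposable past set), and the
--   past cone of the ideal end is regular up to the concentration scale of ScaleCriticalUpgrade
--   (regularity of the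

/-- item stmt-FinalStateConjecture-10213 · support · rank 9 · open · by planner
sources: Christodoulou1999, KlainermanNicolo2003, arXiv:2211.15230, HawkingEllis1973
[support] VISIBLE INCOMPLETE RAY (card P2 with P1; the sanity rung of NoFourthExit, of which it is a
corollary, provable independently): a maximal vacuum Cauchy development of an admissible datum with
incomplete 𝓘⁺ (sojourn form) contains a visible future-incomplete null geodesic. The sojourn
negation supplies future-incomplete normalised rays from arbitrarily far out with small sojourn in
J⁺(ιB₀); asymptotically flat exterior stability (Klainerman–Nicolò / Shen region: complete outgoing
cones from large spheres of X) makes their points visible. Tests the visibility idiom; rests on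
exterior stability for the admissible class (no named fact yet). [difficulty: L] -/
@[route_item "route-FinalStateConjecture-CurvatureOrSymmetry"]
def VisibleIncompleteRay : Prop :=
  ∀ (X : Type) [TopologicalSpace X] [ChartedSpace Literature.Geometry.Lorentzian.E3 X] [IsManifold (𝓡 3) ((⊤ : ℕ∞) : WithTop ℕ∞) X] [T2Space X] [SecondCountableTopology X] [ConnectedSpace X], ∀ D ∈ Literature.Geometry.Lorentzian.admissibleVacuumData X, ∀ 𝒟 : Literature.Geometry.Lorentzian.VacuumCauchyDevelopment D, 𝒟.IsMaximal → ¬ Summit.FinalStateConjecture.HasCompleteNullInfinity 𝒟.toCauchyDevelopment → ∀ [𝒟.metric.HasLeviCivita], ∃ (γ : ℝ → 𝒟.carrier) (dom : Set ℝ), (Literature.Geometry.Lorentzian.IsMaximalGeodesicOn 𝒟.metric.leviCivita γ dom ∧ (0 : ℝ) ∈ dom ∧ BddAbove dom ∧ (∀ t ∈ dom, 𝒟.metric.IsNull (Literature.Geometry.Lorentzian.velocity (𝓡 4) γ t) ∧ 𝒟.timeOrientation.IsFutureDirected (Literature.Geometry.Lorentzian.velocity (𝓡 4) γ t)) ∧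 (∀ t ∈ dom, 0 ≤ t → (∃ (p : X) (δ : ℝ → 𝒟.carrier) (s : Set ℝ), 𝒟.metric.IsNormalisedNullRayFrom 𝒟.timeOrientation 𝒟.embed 𝒟.normal p δ s ∧ ¬ BddAbove s ∧ γ t ∈ 𝒟.metric.chronologicalPast 𝒟.timeOrientation (δ '' (s ∩ Set.Ici 0)))))

/-- item stmt-FinalStateConjecture-17350 · support · rank 9 · closed · proved by Summit.FinalStateConjecture.FinalStateConjecture.Theorems.TameLocalExitSuffices_proof @ 741678c42339 (prover) · by planner
sources: Christodoulou1999, Christodoulou1999instability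
[support] TAME LOCAL EXIT SUFFICES (re-type T2 of LocalExitSuffices; provable now): if through D
passes, on some end e, a tame (`IsTameDataFamily e 1 F`), immersed-at-0 (`IsImmersedAtZero 1 F`),
injective admissible one-parameter family with F 0 = D whose members with 0 < ‖c‖ < ε avoid an
exceptional set 𝓔, then through D passes one on the same e all of whose members with c ≠ 0 avoid 𝓔 —
reparametrise by the squash σ c = (ε·arctan(c₀)/2) e₀ (`PhotonSphereChannels.squash_spec`,
`PhotonSphereChannels.isSmoothDataFamily_comp`, exactly as
Theorems/CurvatureOrSymmetryLocalExitSuffices.lean does for the smooth class): IsSoleEnd and the ∀ c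
DR-flatness are untouched, M ∘ σ is continuous, the wDist-continuity at 0 composes with σ → 0 (σ 0 =
0, `Tendsto.comp`), immersion survives by the chain rule (`fderiv_comp`; dσ(0) = (ε/2)·id, and a
non-zero fderiv at 0 forces differentiability there), injectivity composes. [difficulty:
provable-now] -/
@[route_item "route-FinalStateConjecture-CurvatureOrSymmetry"]
def TameLocalExitSuffices : Prop :=
  ∀ (X : Type) [TopologicalSpace X] [ChartedSpace Literature.Geometry.Lorentzian.E3 X] [IsManifold (𝓡 3) ((⊤ : ℕ∞) : WithTop ℕ∞) X] [T2Space X] [SecondCountableTopology X] [ConnectedSpace X] (𝓔 : Set (Literature.Geometry.Lorentzian.InitialDataSet (𝓡 3) X)) (D : Literature.Geometry.Lorentzian.InitialDataSet (𝓡 3) X), (∃ (e : Literature.Geometry.Lorentzian.AFEnd X) (F : EuclideanSpace ℝ (Fin 1) → Literature.Geometry.Lorentzian.InitialDataSet (𝓡 3) X), Literature.Geometry.Lorentzian.InitialDataSet.IsTameDataFamily e 1 F ∧ Literature.Geometry.Lorentzian.InitialDataSet.IsImmersedAtZero 1 F ∧ F 0 = D ∧ Function.Injective F ∧ (∀ c,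 F c ∈ Literature.Geometry.Lorentzian.admissibleVacuumData X) ∧ ∃ ε : ℝ, 0 < ε ∧ ∀ c, c ≠ 0 → ‖c‖ < ε → F c ∉ 𝓔) → ∃ (e : Literature.Geometry.Lorentzian.AFEnd X) (F : EuclideanSpace ℝ (Fin 1) → Literature.Geometry.Lorentzian.InitialDataSet (𝓡 3) X), Literature.Geometry.Lorentzian.InitialDataSet.IsTameDataFamily e 1 F ∧ Literature.Geometry.Lorentzian.InitialDataSet.IsImmersedAtZero 1 F ∧ F 0 = D ∧ Function.Injective F ∧ (∀ c, F c ∈ Literature.Geometry.Lorentzian.admissibleVacuumData X) ∧ ∀ c, c ≠ 0 → F c ∉ 𝓔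

-- `TameLocalExitSuffices` holds: proved by `Summit.FinalStateConjecture.FinalStateConjecture.Theorems.TameLocalExitSuffices_proof` @ 741678c42339 (its module imports this route file, so no `_holds` link can be stated here).

/-- item stmt-FinalStateConjecture-9938 · support · rank 9 · closed · proved by Summit.FinalStateConjecture.FinalStateConjecture.Theorems.LocalExitSuffices_proof @ 442927d8e260 (prover) · by planner
sources: Christodoulou1999, Christodoulou1999instability
[support] LOCAL EXIT SUFFICES (provable now): if through D passes a jointly smooth injective
admissible one-parameter family whose members with 0 < ‖c‖ < ε avoid an exceptional set 𝓔, then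
through D passes one all of whose members with c ≠ 0 avoid 𝓔 — reparametrise by the smooth injective
map c ↦ (ε/2)·c/√(1+‖c‖²) of ℝ¹ onto the punctured-at-nothing ε/2-ball (composition keeps
`IsSmoothDataFamily 1`, injectivity and F 0 = D). [difficulty: provable-now] -/
@[route_item "route-FinalStateConjecture-CurvatureOrSymmetry"]
def LocalExitSuffices : Prop :=
  ∀ (X : Type) [TopologicalSpace X] [ChartedSpace Literature.Geometry.Lorentzian.E3 X] [IsManifold (𝓡 3) ((⊤ : ℕ∞) : WithTop ℕ∞) X] [T2Space X] [SecondCountableTopology X] [ConnectedSpace X] (𝓔 : Set (Literature.Geometry.Lorentzian.InitialDataSet (𝓡 3) X)) (D : Literature.Geometry.Lorentzian.InitialDataSet (𝓡 3) X), (∃ F : EuclideanSpace ℝ (Fin 1) → Literature.Geometry.Lorentzian.InitialDataSet (𝓡 3) X, Literature.Geometry.Lorentzian.InitialDataSet.IsSmoothDataFamily 1 F ∧ F 0 = D ∧ Function.Injective F ∧ (∀ c, F c ∈ Literature.Geometry.Lorentzian.admissibleVacuumData X) ∧ ∃ ε : ℝ, 0 < ε ∧ ∀ c, c ≠ 0 →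 ‖c‖ < ε → F c ∉ 𝓔) → ∃ F : EuclideanSpace ℝ (Fin 1) → Literature.Geometry.Lorentzian.InitialDataSet (𝓡 3) X, Literature.Geometry.Lorentzian.InitialDataSet.IsSmoothDataFamily 1 F ∧ F 0 = D ∧ Function.Injective F ∧ (∀ c, F c ∈ Literature.Geometry.Lorentzian.admissibleVacuumData X) ∧ ∀ c, c ≠ 0 → F c ∉ 𝓔

-- `LocalExitSuffices` holds: proved by `Summit.FinalStateConjecture.FinalStateConjecture.Theorems.LocalExitSuffices_proof` @ 442927d8e260 (its module imports this route file, so no `_holds` link can be stated here).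

-- earlier Assembly (stmt-FinalStateConjecture-10214, replaced 2026-08-16T23:16:45Z -> stmt-FinalStateConjecture-17349): retired by None — MGHDExistence → LocalExitSuffices → NoFourthExit → NoVacuumFountains → CurvatureModeExit → CensoredDataExit → FinalStateConjecture
-- earlier Assembly (stmt-FinalStateConjecture-17349, replaced 2026-08-16T23:33:51Z -> stmt-FinalStateConjecture-17756): retired by None — MGHDExistence → TameLocalExitSuffices → NoFourthExit → NoVacuumFountains → TameCurvatureModeExit → TameCensoredDataExit → FinalStateConjecture
/-- item stmt-FinalStateConjecture-17756 · assembly · rank 1 · closed · proved by Summit.FinalStateConjecture.FinalStateConjecture.Theorems.CurvatureOrSymmetry.assemblyT2_frame_proof (prover) · by planner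
sources: Christodoulou1999, DafermosLuk2017
[assembly] NoFourthExit → NoVacuumFountains → TameCurvatureModeExit → TameCensoredDataExit →
MGHDExistence → FinalStateConjecture (crux-only, 2026-08-16: literally the type of the deciding
theorem `closes`, cruxes in rank order 2, 3, 4, 5, 9; the local-to-global reparametrisation formerly
assumed as the support TameLocalExitSuffices — proved, stmt-FinalStateConjecture-17350 — is
discharged inside `closes` by `InitialDataSet.isTameChristodoulouGeneric_of_local`,
Literature/Geometry/Lorentzian/TameGenericityLocal.lean). -/
@[route_item "route-FinalStateConjecture-CurvatureOrSymmetry"]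
def Assembly : Prop :=
  NoFourthExit → NoVacuumFountains → TameCurvatureModeExit → TameCensoredDataExit → MGHDExistence → FinalStateConjecture

/-- `Assembly` holds: proved by `Summit.FinalStateConjecture.FinalStateConjecture.Theorems.CurvatureOrSymmetry.assemblyT2_frame_proof`. -/
theorem Assembly_holds : Assembly := _root_.Summit.FinalStateConjecture.FinalStateConjecture.Theorems.CurvatureOrSymmetry.assemblyT2_frame_proof

-- records of items no longer active in this route (dropped / restated):
-- earlier CurvatureModeExit (stmt-FinalStateConjecture-10212, replaced 2026-08-16T23:16:45Z -> stmt-FinalStateConjecture-17347): retired by None — ∀ (X : Type) [TopologicalSpace X] [ChartedSpace Literature.Geometry.Lorentzian.E3 X] [IsManifold (𝓡 3) ((⊤ : ℕ∞) : WithTop ℕ∞) X] [T2Space X] [SecondCountableTopology X] [ConnectedSpace X], ∀ D ∈ Literature.Geometry.Lorentzian.admissibleVacuumData X, (∃ 𝒟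
-- earlier CensoredDataExit (stmt-FinalStateConjecture-9936, replaced 2026-08-16T23:16:45Z -> stmt-FinalStateConjecture-17348): moot by None — ∀ (X : Type) [TopologicalSpace X] [ChartedSpace Literature.Geometry.Lorentzian.E3 X] [IsManifold (𝓡 3) ((⊤ : ℕ∞) : WithTop ℕ∞) X] [T2Space X] [SecondCountableTopology X] [ConnectedSpace X], ∀ D ∈ Literature.Geometry.Lorentzian.admissibleVacuumData X, (∃ 𝒟 : Li

/-! D-0027 §2.1 — DECIDING THEOREM (planner-authored via `route open/edit --closes-file`; by planner-rbadge-FinalStateConjecture-CurvatureO-3c6a8b25-0 2026-08-16T23:33:51Z):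
its hypotheses are this route's items and its conclusion the sub-problem Statement (glue_lint), and it elaborates with this file. -/

/-- The deciding theorem of route CurvatureOrSymmetry (D-0027 §2.1), CRUX-ONLY form (2026-08-16, layer
invariant: every hypothesis is a crux of this route — `NoFourthExit` r2, `NoVacuumFountains` r3,
`TameCurvatureModeExit` r4, `TameCensoredDataExit` r5 and the shared MGHD-existence crux `MGHDExistence` r9;
the local-to-global reparametrisation formerly assumed as the support `TameLocalExitSuffices` — proved,
item stmt-FinalStateConjecture-17350 — is now discharged INSIDE the proof by the Literature lemma
`InitialDataSet.isTameChristodoulouGeneric_of_local`, TameGenericityLocal.lean: tame genericity is local in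
the parameter). Pure logic. Fix `X`; by `isTameChristodoulouGeneric_of_local` it suffices to pass through
every exceptional admissible datum `D` a tame, immersed-at-`0`, injective admissible curve on one end whose
members with `0 < ‖c‖ < ε` are good. If every maximal development of `D` has complete future null infinity,
`D` is censored: `MGHDExistence` gives an MGHD, exceptionality of `D` yields a maximal development without a
future-oriented, honestly exhaustive, sub-extremal Kerr decomposition of its self-determined exterior keeping
the complete null rays in its closure, and `TameCensoredDataExit` supplies the local tame exit. Otherwise some
MGHD `𝒟` has incomplete `𝓘⁺`; `NoFourthExit` gives a visible incomplete null ray of `𝒟` ending in a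
p.p.-curvature singularity or carrying a Killing-horizon shadow; `NoVacuumFountains` excludes the second
alternative when the first fails, so the ray is curvature-singular and `TameCurvatureModeExit` supplies the
local tame exit. The instance binder `∀ [g.HasLeviCivita]` is threaded, never discharged. -/
@[closes "route-FinalStateConjecture-CurvatureOrSymmetry"] theorem closes (hN : NoFourthExit) (hF : NoVacuumFountains) (hA : TameCurvatureModeExit)
    (hB : TameCensoredDataExit) (hM : MGHDExistence) : FinalStateConjecture := by
  intro X _ _ _ _ _ _
  refine Literature.Geometry.Lorentzian.InitialDataSet.isTameChristodoulouGeneric_of_local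
    fun D hAdm hbad ↦ ?_
  by_cases hC : ∀ 𝒟 : Literature.Geometry.Lorentzian.VacuumCauchyDevelopment D, 𝒟.IsMaximal →
      Summit.FinalStateConjecture.HasCompleteNullInfinity 𝒟.toCauchyDevelopment
  · obtain ⟨𝒟₀, h𝒟₀⟩ := hM X D hAdm
    have hns : ∃ 𝒟 : Literature.Geometry.Lorentzian.VacuumCauchyDevelopment D, 𝒟.IsMaximal ∧
        ¬ ∃ (O : Set 𝒟.carrier) (d : Literature.Geometry.Lorentzian.FinalStateDecomposition 𝒟.toSpacetime O 2),
          (∀ i, Literature.Geometry.Lorentzian.Kerr.IsSubextremal (d.mass i) (d.spin i)) ∧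
            O = Summit.FinalStateConjecture.exteriorOf 𝒟.toCauchyDevelopment d.charted ∧
              Summit.FinalStateConjecture.RaysStayInClosure 𝒟.toCauchyDevelopment O ∧
                Summit.FinalStateConjecture.HasExhaustiveCharts d ∧
                  Summit.FinalStateConjecture.IsFutureOriented d := by
      by_contra hcon
      refine hbad ⟨⟨𝒟₀, h𝒟₀⟩, fun 𝒟 h𝒟 ↦ ⟨hC 𝒟 h𝒟, ?_⟩⟩
      by_contra hset
      exact hcon ⟨𝒟, h𝒟, hset⟩
    obtain ⟨e, F, hF, hI, h0, hinj, hadm, ε, hε, hgood⟩ := hB X D hAdm ⟨𝒟₀, h𝒟₀⟩ hC hns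
    exact ⟨e, F, hF, hI, h0, hinj, hadm, ε, hε, hgood⟩
  · obtain ⟨𝒟, h𝒟⟩ := not_forall.mp hC
    obtain ⟨h𝒟max, hinc⟩ := Classical.not_imp.mp h𝒟
    obtain ⟨e, F, hF, hI, h0, hinj, hadm, ε, hε, hgood⟩ := hA X D hAdm ⟨𝒟, h𝒟max, hinc, by
      intro inst
      obtain ⟨γ, dom, hγ, halt⟩ := hN X D hAdm 𝒟 h𝒟max hinc
      have hnof := hF X D hAdm 𝒟 h𝒟max
      rcases halt with hpp | hkh
      · exact ⟨γ, dom, hγ, hpp⟩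
      · exact (em _).elim (fun hpp ↦ ⟨γ, dom, hγ, hpp⟩)
          (fun hnpp ↦ absurd ⟨γ, dom, hγ, hnpp, hkh⟩ hnof)⟩
    exact ⟨e, F, hF, hI, h0, hinj, hadm, ε, hε, hgood⟩

end Summit.FinalStateConjecture.FinalStateConjecture.Theses.CurvatureOrSymmetry
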